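import Summits.CriticalPhenomena.PercolationContinuityZ3.Theorems.SahiMasterFamilyResidualThree

/-!
# (EQ-3) on the principal stratum: `E₃(A, B, cylinder) = 0 ⟺ (Z)`, unconditionally; hence (EQ-3) holds off the residual class

Companion of `SahiMasterFamily.lean` / `SahiMasterFamilyResidualThree.lean` (crux `NoHeavyLowerTail`,
stmt-CriticalPhenomena-4575; unit `prim-masterthm-p4`).  The master equality conjecture `MasterFamilyEqIff 3`
(`E₃(μ_p; 1_U) = 0 ↔ U ∈ Z_3` for `p` in the open cube) is proved here on the stratum "one slot is a principal
up-set (cylinder) `P = {ω | S ⊆ ω}`", for EVERY finite `ι`, by Blinovsky's chain [Blinovsky2013, Appendix]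
  `P(P)·E₃(A,B,P) = [P(P)P(ABP) − P(AP)P(BP)] + P(P)[P(ABP) − P(P)P(AB)] + [P(AP) − P(A)P(P)]·[P(BP) − P(B)P(P)]`
whose three brackets are ≥ 0 (FKG conditionally on the cylinder = FKG for the log-supermodular weight `μ·1_P`
[Blinovsky2013, Lemma]; Harris; Harris × Harris).  So `E₃ = 0` forces all three to vanish, i.e.
`A∩B ⟂ P`, (`A ⟂ P` or `B ⟂ P`), and then `A ⟂ B∩P` (resp. `B ⟂ A∩P`) — three INDEPENDENCE equations, each turned
into "determined by disjoint coordinate sets" by strict Harris (`disjoint_determinedBy_of_real_inter_eq`), which is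
criterion (Z) with the flag at the slot of `B` (resp. `A`).  No conditional strict Harris is needed.
Results: `sahiE_three_ind_eq_zero_iff_of_cylinder` (slot `2` a cylinder), and — with the nested-pair stratum
(`sahiE_three_ind_eq_zero_iff_of_subset`) and the independent-pair stratum
(`sahiE_three_ind_eq_zero_iff_of_indepPair`) — `sahiE_three_ind_eq_zero_iff_of_not_residual`: (EQ-3) holds for every
triple outside the residual class `𝓡₃` (pairwise-dependent antichains without principal member; principal member
placed in slot `2`, the statement being symmetric).  Consequently (EQ-3) ⟺ "`E₃(μ_p) ≠ 0` at every interior `p` for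
every triple of `𝓡₃`" (𝓡₃ ∩ Z₃ = ∅ since every `Z₃`-triple has an independent pair).  Nothing here asserts (EQ-3).
[this work] -/

noncomputable section

open scoped Classical

namespace Summit.CriticalPhenomena.PercolationContinuityZ3.Theorems

open Finset Function
open Literature.Combinatorics.Sahi2008
open Literature.Probability.Percolation (DeterminedBy)
open Literature.Probability.Percolation.DecisionTree (ind ind_of_mem ind_of_not_mem ind_nonneg)

variable {ι : Type} [Fintype ι]

omit [Fintype ι] in
/-- `1_A · 1_B = 1_{A ∩ B}`. [folklore] -/
theorem ind_mul_ind_eq_inter (A B : Set (Set ι)) : ind A * ind B = ind (A ∩ B) := by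
  funext ω; exact (Literature.Probability.Percolation.BHK2006.ind_inter A B ω).symm

omit [Fintype ι] in
/-- Cylinders `{ω | S ⊆ ω}` are increasing. [folklore] -/
theorem isUpperSet_cylinder (S : Set ι) : IsUpperSet {ω : Set ι | S ⊆ ω} :=
  fun _ _ hle hω => Set.Subset.trans hω hle

/-- **Harris in `ex`/`ind` form**: `E(1_A)E(1_B) ≤ E(1_{A∩B})` for increasing events under a product weight.
[cite: Harris1960, Lemma 4.1; LiebSahi2021, eq. (1.2)] -/
theorem harris_ex_ind (p : ι → unitInterval) {A B : Set (Set ι)} (hA : IsUpperSet A) (hB : IsUpperSet B) :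
    ex (bernoulliWeight p) (ind A) * ex (bernoulliWeight p) (ind B) ≤ ex (bernoulliWeight p) (ind (A ∩ B)) := by
  have hμ := isFKGMeasure_bernoulliWeight p
  have h := fkg (ind A) (ind B) (bernoulliWeight p) (fun ω => hμ.nonneg ω) (fun ω => ind_nonneg A ω)
    (fun ω => ind_nonneg B ω) (monotone_ind_of_isUpperSet hA) (monotone_ind_of_isUpperSet hB) hμ.mul_le_mul
  rw [hμ.sum_eq_one, one_mul] at h
  rw [← ind_mul_ind_eq_inter]
  exact h

/-- **FKG conditionally on a cylinder** (Blinovsky's Lemma for the product weight): for increasing `A, B` and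
`P = {ω | S ⊆ ω}`, `E(1_{A∩P})E(1_{B∩P}) ≤ E(1_P)E(1_{A∩B∩P})` — the weight `μ·1_P` is log-supermodular.
[cite: Blinovsky2013, Lemma (arXiv text p. 1)] -/
theorem condHarris_ex_ind_cylinder (p : ι → unitInterval) (S : Set ι) {A B : Set (Set ι)} (hA : IsUpperSet A)
    (hB : IsUpperSet B) :
    ex (bernoulliWeight p) (ind (A ∩ {ω | S ⊆ ω})) * ex (bernoulliWeight p) (ind (B ∩ {ω | S ⊆ ω})) ≤
      ex (bernoulliWeight p) (ind {ω | S ⊆ ω}) * ex (bernoulliWeight p) (ind (A ∩ B ∩ {ω | S ⊆ ω})) := by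
  set P : Set (Set ι) := {ω | S ⊆ ω}
  have hμ := isFKGMeasure_bernoulliWeight p
  -- the restricted weight `ν = μ·1_P`
  set ν : Set ι → ℝ := fun ω => bernoulliWeight p ω * ind P ω with hν
  have hνeq : ∀ ω, ν ω = if S ≤ ω then bernoulliWeight p ω else 0 := fun ω => by
    by_cases h : S ⊆ ω
    · rw [hν]; dsimp only; rw [ind_of_mem (show ω ∈ P from h), mul_one, if_pos h]
    · rw [hν]; dsimp only; rw [ind_of_not_mem (show ω ∉ P from h), mul_zero, if_neg h]
  have hν₀ : 0 ≤ ν := fun ω => mul_nonneg (hμ.nonneg ω) (ind_nonneg P ω)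
  have hνlat : ∀ a b, ν a * ν b ≤ ν (a ⊓ b) * ν (a ⊔ b) := fun a b => by
    rw [hνeq, hνeq, hνeq, hνeq]
    exact Literature.Probability.LatticeModels.logSupermodular_restrict_principal (fun ω => hμ.nonneg ω)
      hμ.mul_le_mul S a b
  have h := fkg (ind A) (ind B) ν hν₀ (fun ω => ind_nonneg A ω) (fun ω => ind_nonneg B ω)
    (monotone_ind_of_isUpperSet hA) (monotone_ind_of_isUpperSet hB) hνlat
  -- translate the four sums
  have e1 : ∀ C : Set (Set ι), (∑ ω, ν ω * ind C ω) = ex (bernoulliWeight p) (ind (C ∩ P)) := fun C => by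
    simp only [ex, hν]
    refine Finset.sum_congr rfl fun ω _ => ?_
    rw [Literature.Probability.Percolation.BHK2006.ind_inter]; ring
  have e0 : (∑ ω, ν ω) = ex (bernoulliWeight p) (ind P) := by simp only [ex, hν]
  have e2 : (∑ ω, ν ω * (ind A ω * ind B ω)) = ex (bernoulliWeight p) (ind (A ∩ B ∩ P)) := by
    rw [← e1 (A ∩ B)]
    refine Finset.sum_congr rfl fun ω _ => ?_
    rw [Literature.Probability.Percolation.BHK2006.ind_inter]
  rw [e1, e1, e0, e2] at h
  exact h

/-- **Blinovsky's chain for `(A, B, P)`**: `E(1_P)·E₃(1_A,1_B,1_P) = T₁ + T₂ + T₃` with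
`T₁ = E(P)E(ABP) − E(AP)E(BP)`, `T₂ = E(P)(E(ABP) − E(P)E(AB))`, `T₃ = (E(AP) − E(A)E(P))(E(BP) − E(B)E(P))`
(any weight). [cite: Blinovsky2013, Appendix (arXiv text p. 3)] -/
theorem sahiE_three_ind_mul_eq (μ : Set ι → ℝ) (A B P : Set (Set ι)) :
    ex μ (ind P) * sahiE μ 3 ![ind A, ind B, ind P] =
      (ex μ (ind P) * ex μ (ind (A ∩ B ∩ P)) - ex μ (ind (A ∩ P)) * ex μ (ind (B ∩ P))) +
        ex μ (ind P) * (ex μ (ind (A ∩ B ∩ P)) - ex μ (ind P) * ex μ (ind (A ∩ B))) +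
        (ex μ (ind (A ∩ P)) - ex μ (ind A) * ex μ (ind P)) * (ex μ (ind (B ∩ P)) - ex μ (ind B) * ex μ (ind P)) := by
  rw [sahiE_three]
  simp only [ind_mul_ind_eq_inter]
  ring

/-- **(EQ-3) on the principal stratum, `⇒`**: for `p` in the open cube, increasing `A, B` and a cylinder
`P = {ω | S ⊆ ω}`, `E₃(1_A, 1_B, 1_P) = 0` implies `(A, B, P) ∈ Z₃`. [this work] -/
theorem suppZeroFlag_three_of_sahiE_eq_zero_cylinder (p : ι → unitInterval) (hp : ∀ e, (p e : ℝ) ∈ Set.Ioo (0 : ℝ) 1)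
    {A B : Set (Set ι)} (hA : IsUpperSet A) (hB : IsUpperSet B) (S : Set ι)
    (h0 : sahiE (bernoulliWeight p) 3 ![ind A, ind B, ind {ω | S ⊆ ω}] = 0) :
    SuppZeroFlag 3 ![A, B, {ω | S ⊆ ω}] := by
  set P : Set (Set ι) := {ω | S ⊆ ω} with hPdef
  have hP : IsUpperSet P := isUpperSet_cylinder S
  set μ := bernoulliWeight p
  -- the three nonnegative brackets
  have hT1 : 0 ≤ ex μ (ind P) * ex μ (ind (A ∩ B ∩ P)) - ex μ (ind (A ∩ P)) * ex μ (ind (B ∩ P)) :=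
    sub_nonneg.2 (condHarris_ex_ind_cylinder p S hA hB)
  have hπ0 : 0 ≤ ex μ (ind P) := ex_nonneg (fun ω => (isFKGMeasure_bernoulliWeight p).nonneg ω) (ind_nonneg P)
  have hT2 : 0 ≤ ex μ (ind P) * (ex μ (ind (A ∩ B ∩ P)) - ex μ (ind P) * ex μ (ind (A ∩ B))) := by
    refine mul_nonneg hπ0 (sub_nonneg.2 ?_)
    rw [mul_comm]
    exact harris_ex_ind p (hA.inter hB) hP
  have hA' : 0 ≤ ex μ (ind (A ∩ P)) - ex μ (ind A) * ex μ (ind P) := sub_nonneg.2 (harris_ex_ind p hA hP)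
  have hB' : 0 ≤ ex μ (ind (B ∩ P)) - ex μ (ind B) * ex μ (ind P) := sub_nonneg.2 (harris_ex_ind p hB hP)
  have hT3 := mul_nonneg hA' hB'
  have hsum := sahiE_three_ind_mul_eq μ A B P
  rw [h0, mul_zero] at hsum
  -- all three brackets vanish
  have hT1z : ex μ (ind P) * ex μ (ind (A ∩ B ∩ P)) - ex μ (ind (A ∩ P)) * ex μ (ind (B ∩ P)) = 0 := by linarith
  have hT2z : ex μ (ind P) * (ex μ (ind (A ∩ B ∩ P)) - ex μ (ind P) * ex μ (ind (A ∩ B))) = 0 := by linarith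
  have hT3z : (ex μ (ind (A ∩ P)) - ex μ (ind A) * ex μ (ind P)) *
      (ex μ (ind (B ∩ P)) - ex μ (ind B) * ex μ (ind P)) = 0 := by linarith
  -- `E(1_P) > 0` in the open cube (`univ ∈ P`)
  have hπ : 0 < ex μ (ind P) := by
    have h1 : μ Set.univ * ind P Set.univ ≤ ex μ (ind P) :=
      Finset.single_le_sum (f := fun ω => μ ω * ind P ω)
        (fun ω _ => mul_nonneg ((isFKGMeasure_bernoulliWeight p).nonneg ω) (ind_nonneg P ω)) (Finset.mem_univ _)
    rw [ind_of_mem (show (Set.univ : Set ι) ∈ P from Set.subset_univ S), mul_one] at h1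
    exact lt_of_lt_of_le (bernoulliWeight_pos hp _) h1
  -- bracket 2: `A ∩ B ⟂ P`
  have hABP : ex μ (ind (A ∩ B) * ind P) = ex μ (ind (A ∩ B)) * ex μ (ind P) := by
    rw [ind_mul_ind_eq_inter]
    have := (mul_eq_zero.1 hT2z).resolve_left hπ.ne'
    linarith
  obtain ⟨S2, T2, hST2, hS2, hT2'⟩ := disjoint_determinedBy_of_real_inter_eq p hp (hA.inter hB) hP hABP
  have hZ2 : SuppZeroFlag 2 ![A ∩ B, P] := ⟨S2, T2, hST2, hS2, hT2'⟩
  -- bracket 3: `A ⟂ P` or `B ⟂ P`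
  rcases mul_eq_zero.1 hT3z with h3 | h3
  · -- `A ⟂ P`; then bracket 1 gives `A ⟂ B ∩ P`
    have hAP : ex μ (ind A * ind P) = ex μ (ind A) * ex μ (ind P) := by rw [ind_mul_ind_eq_inter]; linarith
    have hABP' : ex μ (ind A * ind (B ∩ P)) = ex μ (ind A) * ex μ (ind (B ∩ P)) := by
      rw [ind_mul_ind_eq_inter, ← Set.inter_assoc]
      have e : ex μ (ind (A ∩ P)) = ex μ (ind A) * ex μ (ind P) := by linarith
      rw [e] at hT1z
      -- π·abp = a·π·bp ⇒ abp = a·bp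
      have : ex μ (ind P) * (ex μ (ind (A ∩ B ∩ P)) - ex μ (ind A) * ex μ (ind (B ∩ P))) = 0 := by linarith
      have := (mul_eq_zero.1 this).resolve_left hπ.ne'
      linarith
    obtain ⟨S0, T0, hST0, hS0, hT0⟩ := disjoint_determinedBy_of_real_inter_eq p hp hA hP hAP
    obtain ⟨S1, T1, hST1, hS1, hT1'⟩ := disjoint_determinedBy_of_real_inter_eq p hp hA (hB.inter hP) hABP'
    -- flag at slot 1 (`B`): deleted family `(A, P)`, modified `(A ∩ B, P)` and `(A, P ∩ B)`
    refine ⟨1, ?_, fun l => ?_⟩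
    · have e : (fun j : Fin 2 => (![A, B, P] : Fin 3 → Set (Set ι)) ((1 : Fin 3).succAbove j)) = ![A, P] := by
        funext j; fin_cases j <;> rfl
      rw [e]; exact ⟨S0, T0, hST0, hS0, hT0⟩
    · fin_cases l
      · have e : update (fun j : Fin 2 => (![A, B, P] : Fin 3 → Set (Set ι)) ((1 : Fin 3).succAbove j)) 0
            ((![A, B, P] : Fin 3 → Set (Set ι)) ((1 : Fin 3).succAbove 0) ∩ (![A, B, P] : Fin 3 → _) 1) =
            ![A ∩ B, P] := by
          funext j; fin_cases j <;> rfl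
        simp only [Fin.zero_eta]
        rw [e]; exact hZ2
      · have e : update (fun j : Fin 2 => (![A, B, P] : Fin 3 → Set (Set ι)) ((1 : Fin 3).succAbove j)) 1
            ((![A, B, P] : Fin 3 → Set (Set ι)) ((1 : Fin 3).succAbove 1) ∩ (![A, B, P] : Fin 3 → _) 1) =
            ![A, P ∩ B] := by
          funext j; fin_cases j <;> rfl
        simp only [Fin.mk_one]
        rw [e, Set.inter_comm P B]; exact ⟨S1, T1, hST1, hS1, hT1'⟩
  · -- `B ⟂ P`; then bracket 1 gives `B ⟂ A ∩ P`
    have hBP : ex μ (ind B * ind P) = ex μ (ind B) * ex μ (ind P) := by rw [ind_mul_ind_eq_inter]; linarith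
    have hBAP : ex μ (ind B * ind (A ∩ P)) = ex μ (ind B) * ex μ (ind (A ∩ P)) := by
      rw [ind_mul_ind_eq_inter, ← Set.inter_assoc, Set.inter_comm B A]
      have e : ex μ (ind (B ∩ P)) = ex μ (ind B) * ex μ (ind P) := by linarith
      rw [e] at hT1z
      have : ex μ (ind P) * (ex μ (ind (A ∩ B ∩ P)) - ex μ (ind B) * ex μ (ind (A ∩ P))) = 0 := by linarith
      have := (mul_eq_zero.1 this).resolve_left hπ.ne'
      linarith
    obtain ⟨S0, T0, hST0, hS0, hT0⟩ := disjoint_determinedBy_of_real_inter_eq p hp hB hP hBP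
    obtain ⟨S1, T1, hST1, hS1, hT1'⟩ := disjoint_determinedBy_of_real_inter_eq p hp hB (hA.inter hP) hBAP
    -- flag at slot 0 (`A`): deleted family `(B, P)`, modified `(B ∩ A, P)` and `(B, P ∩ A)`
    refine ⟨0, ?_, fun l => ?_⟩
    · have e : (fun j : Fin 2 => (![A, B, P] : Fin 3 → Set (Set ι)) ((0 : Fin 3).succAbove j)) = ![B, P] := by
        funext j; fin_cases j <;> rfl
      rw [e]; exact ⟨S0, T0, hST0, hS0, hT0⟩
    · fin_cases l
      · have e : update (fun j : Fin 2 => (![A, B, P] : Fin 3 → Set (Set ι)) ((0 : Fin 3).succAbove j)) 0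
            ((![A, B, P] : Fin 3 → Set (Set ι)) ((0 : Fin 3).succAbove 0) ∩ (![A, B, P] : Fin 3 → _) 0) =
            ![B ∩ A, P] := by
          funext j; fin_cases j <;> rfl
        simp only [Fin.zero_eta]
        rw [e, Set.inter_comm B A]; exact hZ2
      · have e : update (fun j : Fin 2 => (![A, B, P] : Fin 3 → Set (Set ι)) ((0 : Fin 3).succAbove j)) 1
            ((![A, B, P] : Fin 3 → Set (Set ι)) ((0 : Fin 3).succAbove 1) ∩ (![A, B, P] : Fin 3 → _) 0) =
            ![B, P ∩ A] := by
          funext j; fin_cases j <;> rfl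
        simp only [Fin.mk_one]
        rw [e, Set.inter_comm P A]; exact ⟨S1, T1, hST1, hS1, hT1'⟩

/-- **(EQ-3) on the principal stratum, unconditionally**: for `p` in the open cube and three increasing events
`U_0, U_1, U_2` with `U_2 = {ω | S ⊆ ω}` a cylinder, `E₃(μ_p; 1_U) = 0 ↔ U ∈ Z₃`. [this work] -/
theorem sahiE_three_ind_eq_zero_iff_of_cylinder (p : ι → unitInterval) (hp : ∀ e, (p e : ℝ) ∈ Set.Ioo (0 : ℝ) 1)
    (U : Fin 3 → Set (Set ι)) (hU : ∀ j, IsUpperSet (U j)) (S : Set ι) (hS : U 2 = {ω | S ⊆ ω}) :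
    sahiE (bernoulliWeight p) 3 (fun j => ind (U j)) = 0 ↔ SuppZeroFlag 3 U := by
  refine ⟨fun h => ?_, fun h => masterFamilyEqIff_mpr 3 ι p U h⟩
  have eU : U = ![U 0, U 1, {ω | S ⊆ ω}] := by
    funext j; fin_cases j
    · rfl
    · rfl
    · exact hS
  have eF : (fun j => ind (U j)) = ![ind (U 0), ind (U 1), ind {ω : Set ι | S ⊆ ω}] := by
    funext j; fin_cases j
    · rfl
    · rfl
    · simp [hS]
  rw [eF] at h
  rw [eU]
  exact suppZeroFlag_three_of_sahiE_eq_zero_cylinder p hp (hU 0) (hU 1) S h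

/-- **(EQ-3) off the residual class.**  For `p` in the open cube and three increasing events: if slot `2` is a
cylinder, or some event contains another, or some two events are determined by disjoint coordinate sets, then
`E₃(μ_p; 1_U) = 0 ↔ U ∈ Z₃`.  (By the symmetry of `E₃` and of the three strata, "slot `2`" is no restriction up to
reordering; the complement of the strata is the residual class `𝓡₃` of pairwise-dependent antichains without principal
member, on which (EQ-3) predicts `E₃ ≠ 0`.) [this work] -/
theorem sahiE_three_ind_eq_zero_iff_of_not_residual (p : ι → unitInterval)
    (hp : ∀ e, (p e : ℝ) ∈ Set.Ioo (0 : ℝ) 1) (U : Fin 3 → Set (Set ι)) (hU : ∀ j, IsUpperSet (U j))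
    (h : (∃ S : Set ι, U 2 = {ω | S ⊆ ω}) ∨ (∃ (i : Fin 3) (l₀ : Fin 2), U (i.succAbove l₀) ⊆ U i) ∨
      (∃ m : Fin 3, SuppZeroFlag 2 (fun j => U (m.succAbove j)))) :
    sahiE (bernoulliWeight p) 3 (fun j => ind (U j)) = 0 ↔ SuppZeroFlag 3 U := by
  rcases h with ⟨S, hS⟩ | ⟨i, l₀, hsub⟩ | ⟨m, hZ⟩
  · exact sahiE_three_ind_eq_zero_iff_of_cylinder p hp U hU S hS
  · exact sahiE_three_ind_eq_zero_iff_of_subset p hp U hU i l₀ hsub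
  · exact sahiE_three_ind_eq_zero_iff_of_indepPair p hp U hU m hZ

end Summit.CriticalPhenomena.PercolationContinuityZ3.Theorems
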